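import Literature.AlgebraicGeometry.HodgeTheory.CoordinateEmbedding
import Literature.AlgebraicGeometry.HodgeTheory.FermatCoordinateSection
import Literature.AlgebraicGeometry.HodgeTheory.FermatClaimPermutationInvariance
import HarnessLib

/-!
# The sub-Fermat varieties `Xᵏₘ ⊂ Xⁿₘ` of Shioda's inductive structure and the eigenspaces

Family `hodge`, layer `Literature/AlgebraicGeometry/HodgeTheory`. Sequel of `CoordinateEmbedding`
for the Fermat forms: along an injection `e : Fin (n₁ + 2) ↪ Fin (n + 2)` of coordinate sets the
Fermat form `Σⱼ xⱼᵐ` of `ℙⁿ⁺¹` pulls back to the Fermat form `Σᵢ xᵢᵐ` of `ℙ^{n₁+1}` (`m ≥ 1`), so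
the coordinate embedding `[z] ↦ [ẑ]` restricts to a morphism of `ℂ`-schemes
**`fermatEmb e : X^{n₁}ₘ ⟶ Xⁿₘ`** — the sub-Fermat variety `Xⁿₘ ∩ {x_j = 0, j ∉ e}` (for the two
blocks of coordinates of `X^{2(r+s+1)}ₘ`: the disjoint sub-Fermat varieties `X²ʳₘ = {y = 0}` and
`X²ˢₘ = {x = 0}` joined by lines in Shioda's inductive structure, Shioda–Katsura 1979 §1, Shioda
Math. Ann. 245 (1979) §1, da Silva arXiv:2101.04739 Thm. 2.2). PROVED here:

* `aeval_embSubst_fermatPolynomial` — `σ_e (Σⱼ xⱼᵐ) = Σᵢ xᵢᵐ` for `m ≥ 1`;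
* `fermatEmb`, `fermatEmbMap` and the points formula (from `CoordinateEmbedding`);
* `extendUnits e b ∈ μₘⁿ⁺²` — a diagonal symmetry `b ∈ μₘ^{n₁+2}` of the small Fermat variety
  extended by `1`, with `χ_γ(extendUnits e b) = χ_{γ ∘ e}(b)` (`fermatCharacter_extendUnits`);
* `map_fermatEmbMap_mem_fermatEigenspace` — **`ι^* V(γ) ⊆ V(γ ∘ e)`**: the restriction to a
  sub-Fermat variety of the `γ`-eigenspace of `μₘⁿ⁺²` lies in the `(γ ∘ e)`-eigenspace of
  `μₘ^{n₁+2}` (`g_b^* ι^* = ι^* g_{b̂}^*` by `diagonalMap_comp_coordEmbMap`), the `Gⁿₘ`-equivariance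
  bookkeeping of the inductive structure on the tree's carriers;
* compatibility with the coordinate hyperplane sections of `FermatCoordinateSection` /
  `Motives/ProjectiveSpaceCoordinateEmbedding` (the special case `e = Fin.succAboveEmb k₀`):
  `embSubst_succAboveEmb`, `coordProjEmb_succAboveEmb : coordProjEmb (Fin.succAboveEmb k₀) = skipMap k₀`,
  `fermatEmb_succAboveEmb : fermatEmb (Fin.succAboveEmb k₀) = fermatSection k₀`;
* the two block embeddings `FermatCharacter.embFirst r s`, `FermatCharacter.embSecond r s` of the
  coordinates of `X²ʳₘ`, `X²ˢₘ` into those of `X^{2(r+s+1)}ₘ`, with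
  `append α β ∘ embFirst = α`, `append α β ∘ embSecond = β` and disjoint images: along them
  `ι₁^* V(α∗β) ⊆ V(α)` and `ι₂^* V(α∗β) ⊆ V(β)`.

## What is NOT here

That `ι` is a closed immersion with image `Xⁿₘ ∩ V₊(x_j : j ∉ e)`; the pull-back of algebraic
classes along `ι` (a closed immersion is not flat); the `ℙ¹`-bundle of lines joining the two blocks
and its Gysin map — the remaining geometric layers of the inductive structure.

## References

* [Shioda1979HodgeFermat] T. Shioda, The Hodge conjecture for Fermat varieties, Math. Ann. 245
  (1979) 175–184, §1 (cite-only).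
* [daSilva2021HodgeFermat] G. da Silva Jr., arXiv:2101.04739, Thm. 2.2 (a) (`G`-equivariance)
  (text read).
* [Shioda1979PJA] T. Shioda, Proc. Japan Acad. 55A (1979) 111–114, §4 (the group `Gⁿₘ`, `V(α)`).
-/

noncomputable section

open CategoryTheory AlgebraicGeometry MvPolynomial Finset

namespace Literature.AlgebraicGeometry.HodgeTheory

open Literature.AlgebraicGeometry.Motives Literature.AlgebraicTopology.SingularHomology

attribute [local instance] MvPolynomial.gradedAlgebra Motives.ProjBaseChange.algebraBase

variable {n₁ n m : ℕ}

/-! ### The Fermat form pulls back to the Fermat form -/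

/-- A function extended by zero along `e` sums to the original sum. [folklore] -/
theorem sum_extend_eq_sum {M : Type*} [AddCommMonoid M] (e : Fin (n₁ + 2) ↪ Fin (n + 2)) (g : Fin (n₁ + 2) → M) :
    ∑ j, Function.extend e g 0 j = ∑ i, g i := by
  classical
  rw [← Finset.sum_subset (Finset.subset_univ (Finset.univ.map e)), Finset.sum_map]
  · exact Finset.sum_congr rfl fun i _ ↦ e.injective.extend_apply _ _ i
  · intro j _ hj
    refine Function.extend_apply' _ _ _ fun ⟨i, hi⟩ ↦ hj ?_
    exact Finset.mem_map.mpr ⟨i, Finset.mem_univ _, hi⟩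

/-- A function extended by one along `e` has the original product. [folklore] -/
theorem prod_extend_eq_prod {M : Type*} [CommMonoid M] (e : Fin (n₁ + 2) ↪ Fin (n + 2)) (g : Fin (n₁ + 2) → M) :
    ∏ j, Function.extend e g 1 j = ∏ i, g i := by
  classical
  rw [← Finset.prod_subset (Finset.subset_univ (Finset.univ.map e)), Finset.prod_map]
  · exact Finset.prod_congr rfl fun i _ ↦ e.injective.extend_apply _ _ i
  · intro j _ hj
    refine Function.extend_apply' _ _ _ fun ⟨i, hi⟩ ↦ hj ?_
    exact Finset.mem_map.mpr ⟨i, Finset.mem_univ _, hi⟩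

/-- **`σ_e (x₀ᵐ + ⋯ + x_{n+1}ᵐ) = x₀ᵐ + ⋯ + x_{n₁+1}ᵐ`** for `m ≥ 1`: the variables in the image of
`e` are renamed, the others go to `0ᵐ = 0`. [cite: Shioda1979HodgeFermat, §1] -/
theorem aeval_embSubst_fermatPolynomial (e : Fin (n₁ + 2) ↪ Fin (n + 2)) (hm : 1 ≤ m) :
    aeval (embSubst e) (fermatPolynomial ℂ n m) = fermatPolynomial ℂ n₁ m := by
  rw [fermatPolynomial, fermatPolynomial, map_sum]
  simp_rw [map_pow, aeval_X]
  have h : (fun j ↦ embSubst e j ^ m) = Function.extend e (fun i ↦ (X i : MvPolynomial (Fin (n₁ + 2)) ℂ) ^ m) 0 := by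
    funext j
    by_cases hj : j ∈ Set.range e
    · obtain ⟨i, rfl⟩ := hj
      rw [embSubst_apply_emb, e.injective.extend_apply]
    · rw [embSubst_apply_of_not_mem_range e hj, zero_pow (by omega),
        Function.extend_apply' _ _ _ (fun ⟨i, hi⟩ ↦ hj ⟨i, hi⟩), Pi.zero_apply]
  rw [show ∑ j, embSubst e j ^ m = ∑ j, (fun j ↦ embSubst e j ^ m) j from rfl, h, sum_extend_eq_sum]

/-! ### The sub-Fermat variety `X^{n₁}ₘ ⟶ Xⁿₘ` -/

/-- **The sub-Fermat variety along `e`**: the morphism of `ℂ`-schemes `X^{n₁}ₘ ⟶ Xⁿₘ`,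
`[z] ↦ [ẑ]` (`hypersurfaceCoordEmb` for the Fermat forms, `m ≥ 1`) — for the two coordinate blocks of
`X^{2(r+s+1)}ₘ` these are the sub-Fermat varieties `{y = 0} ≅ X²ʳₘ` and `{x = 0} ≅ X²ˢₘ` of the
inductive structure. [cite: Shioda1979HodgeFermat, §1] [cite: daSilva2021HodgeFermat, Thm. 2.2] -/
def fermatEmb (e : Fin (n₁ + 2) ↪ Fin (n + 2)) (hm : 1 ≤ m) : fermatHypersurface n₁ m ⟶ fermatHypersurface n m :=
  hypersurfaceCoordEmb (fermatPolynomial ℂ n m) (fermatPolynomial ℂ n₁ m) (aeval_embSubst_fermatPolynomial e hm)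

/-- The continuous map `ι : X^{n₁}ₘ(ℂ) → Xⁿₘ(ℂ)` of complex points of the sub-Fermat variety.
[cite: Shioda1979HodgeFermat, §1] -/
def fermatEmbMap (e : Fin (n₁ + 2) ↪ Fin (n + 2)) (hm : 1 ≤ m) :
    C(ComplexPoints (fermatHypersurface n₁ m), ComplexPoints (fermatHypersurface n m)) :=
  coordEmbMap (fermatPolynomial ℂ n m) (fermatPolynomial ℂ n₁ m) (aeval_embSubst_fermatPolynomial e hm)

/-- `fermatEmbMap` is `coordEmbMap` for the Fermat forms (`rfl`). [folklore] -/
theorem fermatEmbMap_eq (e : Fin (n₁ + 2) ↪ Fin (n + 2)) (hm : 1 ≤ m) :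
    fermatEmbMap e hm = coordEmbMap (fermatPolynomial ℂ n m) (fermatPolynomial ℂ n₁ m)
      (aeval_embSubst_fermatPolynomial e hm) := rfl

/-- `ι` is injective on complex points. [folklore] -/
theorem fermatEmbMap_injective (e : Fin (n₁ + 2) ↪ Fin (n + 2)) (hm : 1 ≤ m) :
    Function.Injective (fermatEmbMap e hm) :=
  coordEmbMap_injective _ _ _

/-! ### Compatibility with the coordinate hyperplane sections (`e = Fin.succAboveEmb k₀`) -/

/-- Skipping one coordinate: `embSubst (Fin.succAboveEmb k₀)` is the substitution `skipSubst k₀` of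
`Motives/ProjectiveSpaceCoordinateEmbedding` (`x_{k₀} ↦ 0`, `x_{k₀.succAbove j} ↦ xⱼ`). [folklore] -/
theorem embSubst_succAboveEmb (k₀ : Fin (n + 3)) :
    embSubst (n₁ := n) (n := n + 1) (Fin.succAboveEmb k₀) = ProjectiveSpace.skipSubst (k := ℂ) k₀ := by
  funext j
  refine Fin.succAboveCases k₀ ?_ (fun i ↦ ?_) j
  · rw [ProjectiveSpace.skipSubst_self, embSubst_apply_of_not_mem_range]
    rintro ⟨i, hi⟩
    exact Fin.succAbove_ne k₀ i hi
  · rw [ProjectiveSpace.skipSubst_succAbove]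
    exact embSubst_apply_emb (Fin.succAboveEmb k₀) i

/-- The graded homomorphisms agree: `coordEmbGraded (Fin.succAboveEmb k₀) = skipGraded k₀`. [folklore] -/
theorem coordEmbGraded_succAboveEmb (k₀ : Fin (n + 3)) :
    coordEmbGraded (n₁ := n) (n := n + 1) (Fin.succAboveEmb k₀) = ProjectiveSpace.skipGraded (k := ℂ) k₀ := by
  ext p : 1
  change aeval (embSubst (Fin.succAboveEmb k₀)) p = aeval (ProjectiveSpace.skipSubst k₀) p
  rw [embSubst_succAboveEmb]

/-- **`coordProjEmb (Fin.succAboveEmb k₀) = skipMap k₀`**: the general coordinate embedding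
specialises to the coordinate hyperplane embedding `ℙⁿ⁺¹ ↪ ℙⁿ⁺²` of
`Motives/ProjectiveSpaceCoordinateEmbedding`. [cite: Hartshorne1977, II Ex. 2.14 (b)] -/
theorem coordProjEmb_succAboveEmb (k₀ : Fin (n + 3)) :
    coordProjEmb (n₁ := n) (n := n + 1) (Fin.succAboveEmb k₀) = ProjectiveSpace.skipMap k₀ := by
  ext : 1
  change Proj.map (coordEmbGraded (Fin.succAboveEmb k₀)) (irrelevant_le_map_coordEmbGraded _) =
    Proj.map (ProjectiveSpace.skipGraded k₀) (ProjectiveSpace.irrelevant_le_map_skipGraded k₀)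
  exact projMap_congr (coordEmbGraded_succAboveEmb k₀) _ _

/-- **`fermatEmb (Fin.succAboveEmb k₀) = fermatSection k₀`**: the sub-Fermat variety along the
embedding skipping the coordinate `k₀` is the coordinate hyperplane section of
`FermatCoordinateSection` (both are the unique lift of `Xⁿₘ ↪ ℙⁿ⁺¹ ↪ ℙⁿ⁺²` through `Xⁿ⁺¹ₘ ↪ ℙⁿ⁺²`).
[cite: Shioda1979HodgeFermat, §1] -/
theorem fermatEmb_succAboveEmb (k₀ : Fin (n + 3)) (hm : 1 ≤ m) (hm' : m ≠ 0) :
    fermatEmb (n₁ := n) (n := n + 1) (Fin.succAboveEmb k₀) hm = fermatSection hm' k₀ := by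
  ext : 1
  rw [← cancel_mono (SmoothHypersurface.hypersurfaceι (fermatPolynomial ℂ (n + 1) m)).left, fermatEmb,
    hypersurfaceCoordEmb_left_comp_ι, fermatSection_left_comp_ι, coordProjEmb_succAboveEmb]

/-! ### Diagonal symmetries extended by `1` -/

/-- A diagonal symmetry `b ∈ (ℂˣ)^{n₁+2}` extended by `1` to `(ℂˣ)^{n+2}` along `e`. [folklore] -/
def extendUnits (e : Fin (n₁ + 2) ↪ Fin (n + 2)) (b : Fin (n₁ + 2) → ℂˣ) : Fin (n + 2) → ℂˣ :=
  Function.extend e b 1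

/-- `extendUnits e b (e i) = b i`. [folklore] -/
@[simp]
theorem extendUnits_apply_emb (e : Fin (n₁ + 2) ↪ Fin (n + 2)) (b : Fin (n₁ + 2) → ℂˣ) (i : Fin (n₁ + 2)) :
    extendUnits e b (e i) = b i :=
  e.injective.extend_apply _ _ i

/-- `extendUnits e b j = 1` off the image of `e`. [folklore] -/
theorem extendUnits_apply_of_not_mem_range (e : Fin (n₁ + 2) ↪ Fin (n + 2)) (b : Fin (n₁ + 2) → ℂˣ)
    {j : Fin (n + 2)} (hj : j ∉ Set.range e) : extendUnits e b j = 1 := by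
  rw [extendUnits, Function.extend_apply' _ _ _ (fun ⟨i, hi⟩ ↦ hj ⟨i, hi⟩), Pi.one_apply]

/-- Restricting the extension gives back `b`. [folklore] -/
theorem extendUnits_comp_emb (e : Fin (n₁ + 2) ↪ Fin (n + 2)) (b : Fin (n₁ + 2) → ℂˣ) :
    (fun i ↦ extendUnits e b (e i)) = b :=
  funext (extendUnits_apply_emb e b)

/-- `b ∈ μₘ^{n₁+2} ⟹ extendUnits e b ∈ μₘⁿ⁺²`. [cite: Shioda1979PJA, §4] -/
theorem extendUnits_mem_fermatGroup (e : Fin (n₁ + 2) ↪ Fin (n + 2)) {b : Fin (n₁ + 2) → ℂˣ}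
    (hb : b ∈ fermatGroup n₁ m) : extendUnits e b ∈ fermatGroup n m := by
  refine mem_fermatGroup_iff.mpr fun j ↦ ?_
  by_cases hj : j ∈ Set.range e
  · obtain ⟨i, rfl⟩ := hj
    rw [extendUnits_apply_emb]
    exact mem_fermatGroup_iff.mp hb i
  · rw [extendUnits_apply_of_not_mem_range e b hj, one_pow]

/-- **`χ_γ(b̂) = χ_{γ ∘ e}(b)`** for `b̂ = extendUnits e b`: the factors off the image of `e` are
`1^{⟨γ_j⟩} = 1`. [cite: Shioda1979PJA, §4] -/
theorem fermatCharacter_extendUnits (e : Fin (n₁ + 2) ↪ Fin (n + 2)) (γ : Fin (n + 2) → ZMod m)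
    {b : Fin (n₁ + 2) → ℂˣ} (hb : b ∈ fermatGroup n₁ m) :
    fermatCharacter m γ ⟨extendUnits e b, extendUnits_mem_fermatGroup e hb⟩ =
      fermatCharacter m (γ ∘ e) ⟨b, hb⟩ := by
  rw [fermatCharacter_apply, fermatCharacter_apply]
  change ∏ j, extendUnits e b j ^ (γ j).val = ∏ i, b i ^ (γ (e i)).val
  have h : (fun j ↦ extendUnits e b j ^ (γ j).val) = Function.extend e (fun i ↦ b i ^ (γ (e i)).val) 1 := by
    funext j
    by_cases hj : j ∈ Set.range e
    · obtain ⟨i, rfl⟩ := hj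
      rw [extendUnits_apply_emb, e.injective.extend_apply]
    · rw [extendUnits_apply_of_not_mem_range e b hj, one_pow,
        Function.extend_apply' _ _ _ (fun ⟨i, hi⟩ ↦ hj ⟨i, hi⟩), Pi.one_apply]
  rw [show ∏ j, extendUnits e b j ^ (γ j).val = ∏ j, (fun j ↦ extendUnits e b j ^ (γ j).val) j from rfl, h,
    prod_extend_eq_prod]

/-! ### `ι^* V(γ) ⊆ V(γ ∘ e)` -/

/-- The maps `g_a` depend only on `a` (proof-irrelevant repackaging of the membership). [folklore] -/
theorem diagonalMap_congr {F : MvPolynomial (Fin (n + 2)) ℂ} {a a' : Fin (n + 2) → ℂˣ} (h : a = a')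
    (ha : a ∈ diagonalStabilizer F) (ha' : a' ∈ diagonalStabilizer F) : diagonalMap F ha = diagonalMap F ha' := by
  subst h
  rfl

/-- **`ι^* V(γ) ⊆ V(γ ∘ e)`**: for a class `c` in the `γ`-eigenspace of `μₘⁿ⁺²` on `Hᵏ(Xⁿₘ(ℂ); ℂ)`,
its restriction `ι^* c` to the sub-Fermat variety `X^{n₁}ₘ` lies in the `(γ ∘ e)`-eigenspace of
`μₘ^{n₁+2}`: `g_b^*(ι^* c) = (ι ∘ g_b)^* c = (g_{b̂} ∘ ι)^* c = ι^*(χ_γ(b̂) c) = χ_{γ∘e}(b) ι^* c`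
(`diagonalMap_comp_coordEmbMap`, `fermatCharacter_extendUnits`). This is the `Gⁿₘ`-equivariance of
the restriction to the sub-Fermat varieties in Shioda's inductive structure.
[cite: daSilva2021HodgeFermat, Thm. 2.2 (a)] [cite: Shioda1979PJA, §4] -/
theorem map_fermatEmbMap_mem_fermatEigenspace [NeZero m] (e : Fin (n₁ + 2) ↪ Fin (n + 2)) (hm : 1 ≤ m)
    {γ : Fin (n + 2) → ZMod m} {k : ℕ} {c : complexBetti (fermatHypersurface n m) k}
    (hc : c ∈ fermatEigenspace m γ k) :
    singularCohomology.map ℂ ℂ (fermatEmbMap e hm) k c ∈ fermatEigenspace m (γ ∘ e) k := by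
  rw [mem_fermatEigenspace_iff] at hc ⊢
  intro b
  have hbx : extendUnits e (b : Fin (n₁ + 2) → ℂˣ) ∈ fermatGroup n m := extendUnits_mem_fermatGroup e b.2
  have hres : (fun i ↦ extendUnits e (b : Fin (n₁ + 2) → ℂˣ) (e i)) ∈ diagonalStabilizer (fermatPolynomial ℂ n₁ m) := by
    rw [extendUnits_comp_emb]; exact fermatGroup_le_diagonalStabilizer m b.2
  have hcomm := diagonalMap_comp_coordEmbMap (fermatPolynomial ℂ n m) (fermatPolynomial ℂ n₁ m)
    (aeval_embSubst_fermatPolynomial e hm) (fermatGroup_le_diagonalStabilizer m hbx) hres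
  have hgb : diagonalMap (fermatPolynomial ℂ n₁ m) hres =
      diagonalMap (fermatPolynomial ℂ n₁ m) (fermatGroup_le_diagonalStabilizer m b.2) :=
    diagonalMap_congr (extendUnits_comp_emb e _) _ _
  rw [hgb] at hcomm
  have key : singularCohomology.map ℂ ℂ (diagonalMap _ (fermatGroup_le_diagonalStabilizer m b.2)) k
      (singularCohomology.map ℂ ℂ (fermatEmbMap e hm) k c) =
      singularCohomology.map ℂ ℂ (fermatEmbMap e hm) k
        (singularCohomology.map ℂ ℂ (diagonalMap _ (fermatGroup_le_diagonalStabilizer m hbx)) k c) := by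
    change (singularCohomology.map ℂ ℂ (fermatEmbMap e hm) k ≫
        singularCohomology.map ℂ ℂ (diagonalMap _ (fermatGroup_le_diagonalStabilizer m b.2)) k) c =
      (singularCohomology.map ℂ ℂ (diagonalMap _ (fermatGroup_le_diagonalStabilizer m hbx)) k ≫
        singularCohomology.map ℂ ℂ (fermatEmbMap e hm) k) c
    rw [← singularCohomology.map_comp, ← singularCohomology.map_comp, fermatEmbMap_eq, hcomm]
  rw [key, hc ⟨_, hbx⟩, map_smul, fermatCharacter_extendUnits e γ b.2]

/-! ### The two coordinate blocks of `X^{2(r+s+1)}ₘ` -/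

namespace FermatCharacter

variable {r s : ℕ}

/-- The first block: the coordinates of `X²ʳₘ` inside those of `X^{2(r+s+1)}ₘ` (positions
`0, …, 2r+1`; `Fin.castAdd` through the cast `2(r+s+1)+2 = (2r+2)+(2s+2)`). [cite: daSilva2021HodgeFermat, Thm. 2.2] -/
def embFirst (r s : ℕ) : Fin (2 * r + 2) ↪ Fin (2 * (r + s + 1) + 2) :=
  ⟨fun i ↦ (finCongr (two_mul_add_two r s)).symm (Fin.castAdd (2 * s + 2) i), fun _ _ h ↦
    Fin.castAdd_injective _ _ ((finCongr (two_mul_add_two r s)).symm.injective h)⟩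

/-- The second block: the coordinates of `X²ˢₘ` inside those of `X^{2(r+s+1)}ₘ` (positions
`2r+2, …`; `Fin.natAdd`). [cite: daSilva2021HodgeFermat, Thm. 2.2] -/
def embSecond (r s : ℕ) : Fin (2 * s + 2) ↪ Fin (2 * (r + s + 1) + 2) :=
  ⟨fun i ↦ (finCongr (two_mul_add_two r s)).symm (Fin.natAdd (2 * r + 2) i), fun _ _ h ↦
    Fin.natAdd_injective _ _ ((finCongr (two_mul_add_two r s)).symm.injective h)⟩

/-- **`(α∗β) ∘ embFirst = α`**: the juxtaposed character restricts to `α` on the first block.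
[cite: Aoki1987, §1] -/
@[simp]
theorem append_comp_embFirst (α : Fin (2 * r + 2) → ZMod m) (β : Fin (2 * s + 2) → ZMod m) :
    append α β ∘ embFirst r s = α := by
  funext i
  simp [append, embFirst]

/-- **`(α∗β) ∘ embSecond = β`**: the juxtaposed character restricts to `β` on the second block.
[cite: Aoki1987, §1] -/
@[simp]
theorem append_comp_embSecond (α : Fin (2 * r + 2) → ZMod m) (β : Fin (2 * s + 2) → ZMod m) :
    append α β ∘ embSecond r s = β := by
  funext i
  simp [append, embSecond]

/-- The two blocks are disjoint. [folklore] -/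
theorem embFirst_ne_embSecond (i : Fin (2 * r + 2)) (j : Fin (2 * s + 2)) :
    embFirst r s i ≠ embSecond r s j := by
  intro h
  have h' := congrArg (fun x : Fin (2 * (r + s + 1) + 2) ↦ (x : ℕ)) h
  simp [embFirst, embSecond] at h'
  omega

end FermatCharacter

/-- **`ι₁^* V(α∗β) ⊆ V(α)`** on the first sub-Fermat variety `X²ʳₘ = {y = 0} ⊂ X^{2(r+s+1)}ₘ`.
[cite: daSilva2021HodgeFermat, Thm. 2.2 (a)] -/
theorem map_fermatEmbMap_embFirst_mem [NeZero m] (hm : 1 ≤ m) {r s : ℕ} {α : Fin (2 * r + 2) → ZMod m}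
    {β : Fin (2 * s + 2) → ZMod m} {k : ℕ} {c : complexBetti (fermatHypersurface (2 * (r + s + 1)) m) k}
    (hc : c ∈ fermatEigenspace m (FermatCharacter.append α β) k) :
    singularCohomology.map ℂ ℂ (fermatEmbMap (FermatCharacter.embFirst r s) hm) k c ∈ fermatEigenspace m α k := by
  have h := map_fermatEmbMap_mem_fermatEigenspace (FermatCharacter.embFirst r s) hm hc
  rwa [FermatCharacter.append_comp_embFirst] at h

/-- **`ι₂^* V(α∗β) ⊆ V(β)`** on the second sub-Fermat variety `X²ˢₘ = {x = 0} ⊂ X^{2(r+s+1)}ₘ`.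
[cite: daSilva2021HodgeFermat, Thm. 2.2 (a)] -/
theorem map_fermatEmbMap_embSecond_mem [NeZero m] (hm : 1 ≤ m) {r s : ℕ} {α : Fin (2 * r + 2) → ZMod m}
    {β : Fin (2 * s + 2) → ZMod m} {k : ℕ} {c : complexBetti (fermatHypersurface (2 * (r + s + 1)) m) k}
    (hc : c ∈ fermatEigenspace m (FermatCharacter.append α β) k) :
    singularCohomology.map ℂ ℂ (fermatEmbMap (FermatCharacter.embSecond r s) hm) k c ∈ fermatEigenspace m β k := by
  have h := map_fermatEmbMap_mem_fermatEigenspace (FermatCharacter.embSecond r s) hm hc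
  rwa [FermatCharacter.append_comp_embSecond] at h

end Literature.AlgebraicGeometry.HodgeTheory

end
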